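import Summits.HodgeConjecture.CorCM.Model.TraceKronecker
import Summits.HodgeConjecture.CorCM.RationalExteriorAlgebra
import HarnessLib

/-!
# The Fourier-type word sum on rational Betti cohomology (row M22, socket for K-a/K-b/K-c)

For a smooth projective complex variety `X` of dimension `n`, two families
`x y : Fin N → H¹(X(ℂ); ℚ)` of degree-one classes and degrees `j + i = 2n`, the **Fourier-type word sum**
is the `ℚ`-linear map
`fourierSum hX x y i h : H^j(X(ℂ); ℚ) → H^i(X(ℂ); ℚ)`,
`z ↦ Σ_{c : Fin i → Fin N} tr_X (z ∪ m_i(x ∘ c)) • m_i(y ∘ c)`,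
where `m_i = cupPowOne ℚ X(ℂ) i` is the (right-bracketed) iterated cup product of degree-one classes and
`tr_X = BettiUniverse.tr hX (2n)` is the light trace. This is the Betti transcription of the operator
`fourierOp` of `Literature.AlgebraicGeometry.Motives.AbelianVarietyExterior` (there on an abstract Weil
cohomology); with `x = b` a basis of `H¹` and `y` the polar (dual) basis of a polarization it is, up to the
factor `i!`, the composite "Poincaré duality, then `⋀^i` of the polarization isomorphism `H¹ ≅ (H¹)^∨`",
i.e. the cohomological Fourier–Mukai transform followed by `φ^*` (Beauville 1983, Prop. 1; Huybrechts,
*Fourier–Mukai transforms in algebraic geometry*, Lemma 9.23; Birkenhake–Lange §16.3).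

This file only NAMES the operator (one definition, its unfolding lemma, and two bookkeeping lemmas) so
that the three sub-kernels of BINDER row M22 (`Fact_algDuality` for `Model.universeOf`) — (o) bijectivity,
(i) preservation of algebraic classes, (ii) intertwining with the diagonal CM action — can be stated
against one shared term. Conventions fixed here for all of them: the smooth-projective witness is a
general `hX : IsSmoothProjective n X` and all degrees are written in terms of that `n`; the iterated cup is
the tree's `cupPowOne ℚ (ComplexPoints X) i`; the sum runs over ALL maps `c : Fin i → Fin N`.
-/

noncomputable section

namespace Summit.HodgeConjecture.CorCM.Model

open CategoryTheory
open Literature.AlgebraicTopology.SingularHomology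
open Literature.AlgebraicGeometry.Motives (SchemeOver ComplexPoints IsSmoothProjective bettiCohomology)
open Literature.AlgebraicGeometry.HodgeTheory

universe u

variable {X : SchemeOver ℂ} {n : ℕ}

/-- The **Fourier-type word sum** `z ↦ Σ_{c : Fin i → Fin N} tr_X (z ∪ m_i(x ∘ c)) • m_i(y ∘ c)`,
`H^j(X(ℂ); ℚ) →ₗ[ℚ] H^i(X(ℂ); ℚ)` for `j + i = 2n` (Betti transcription of the Fourier operator of an
abelian variety: Beauville 1983 Prop. 1; Huybrechts, *Fourier–Mukai transforms*, Lemma 9.23). -/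
def fourierSum (hX : IsSmoothProjective n X) {N : ℕ} (x y : Fin N → bettiCohomology X 1) (i : ℕ) {j : ℕ}
    (h : j + i = 2 * n) : bettiCohomology X j →ₗ[ℚ] bettiCohomology X i :=
  ∑ c : Fin i → Fin N,
    ((BettiUniverse.tr hX (2 * n)) ∘ₗ
        (cupProduct h : bettiCohomology X j →ₗ[ℚ] bettiCohomology X i →ₗ[ℚ]
          bettiCohomology X (2 * n)).flip (cupPowOne ℚ (ComplexPoints X) i (x ∘ c))).smulRight
      (cupPowOne ℚ (ComplexPoints X) i (y ∘ c))

/-- Unfolding of `fourierSum`: `fourierSum hX x y i h z = Σ_c tr_X (z ∪ m_i(x ∘ c)) • m_i(y ∘ c)`.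
[folklore] -/
@[simp]
theorem fourierSum_apply (hX : IsSmoothProjective n X) {N : ℕ} (x y : Fin N → bettiCohomology X 1)
    (i : ℕ) {j : ℕ} (h : j + i = 2 * n) (z : bettiCohomology X j) :
    fourierSum hX x y i h z =
      ∑ c : Fin i → Fin N,
        BettiUniverse.tr hX (2 * n) (cupProduct h z (cupPowOne ℚ (ComplexPoints X) i (x ∘ c))) •
          cupPowOne ℚ (ComplexPoints X) i (y ∘ c) := by
  simp [fourierSum]

/-- Every value of `fourierSum hX x y i h` lies in the span of the words `m_i(y ∘ c)`. [folklore] -/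
theorem fourierSum_mem_span (hX : IsSmoothProjective n X) {N : ℕ} (x y : Fin N → bettiCohomology X 1)
    (i : ℕ) {j : ℕ} (h : j + i = 2 * n) (z : bettiCohomology X j) :
    fourierSum hX x y i h z ∈
      Submodule.span ℚ (Set.range fun c : Fin i → Fin N ↦ cupPowOne ℚ (ComplexPoints X) i (y ∘ c)) := by
  rw [fourierSum_apply]
  exact Submodule.sum_mem _ fun c _ ↦
    Submodule.smul_mem _ _ (Submodule.subset_span (Set.mem_range_self c))

/-- Post-composition of `fourierSum` with a linear map `g` that fixes every word `m_i(y ∘ c)` up to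
replacing `y` by `y'`: `g ∘ fourierSum hX x y i h = fourierSum hX x y' i h` whenever
`g (m_i(y ∘ c)) = m_i(y' ∘ c)` for all `c` (bookkeeping used by clause (ii)). [folklore] -/
theorem comp_fourierSum_of_map_words (hX : IsSmoothProjective n X) {N : ℕ}
    (x y y' : Fin N → bettiCohomology X 1) (i : ℕ) {j : ℕ} (h : j + i = 2 * n)
    (g : bettiCohomology X i →ₗ[ℚ] bettiCohomology X i)
    (hg : ∀ c : Fin i → Fin N,
      g (cupPowOne ℚ (ComplexPoints X) i (y ∘ c)) = cupPowOne ℚ (ComplexPoints X) i (y' ∘ c)) :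
    g ∘ₗ fourierSum hX x y i h = fourierSum hX x y' i h := by
  ext z
  simp [fourierSum_apply, map_smul, hg]

end Summit.HodgeConjecture.CorCM.Model

end
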